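import Mathlib
import Summits.Ventures.FusionMHD.Models.TearingFRS1M3DeltaPrime
import Summits.Ventures.FusionMHD.Models.TearingFRS1Physical
import Literature.MathematicalPhysics.MHD.TearingGlasserEffect
import HarnessLib

/-!
# F3.r3 instance «TearingFRS1.M3» ((3,2) mode, `q₀ = 21/20`): the certificate IN THE PRINTED VARIABLES

The `m = 3` copy of `TearingFRS1Physical.lean` (model-6 g5). MODEL M₃'s scaled equation is the AS-PRINTED cylindrical
outer equation `Literature.MathematicalPhysics.MHD.Tearing.IsCylOuterSolution` [Miyamoto2007 §9.4.1 eq. (9.61), the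
`γ² → 0` limit] of the profile

* `profile3 r_s j₀ μ₀ : Tearing.CylProfile` — the SAME current `j(r) = j₀/(1 + r²/a²)²`, `a² = (7/3) r_s²`
  (`TearingFRS1.jz`, `B_θ` by Ampère, `j′`) as the `(2,1)` instance, but the safety factor `q = (21/20)(1 + r²/a²)`
  (`q₀ = 2B_z/(μ₀ j₀ R₀) = 21/20`), so that `q(r_s) = 3/2`: `r_s` is the `(3, 2)` rational surface. CONSISTENCY
  (proved): `hasDerivAt_j3`, `ampere3`, `q_of_Bz3`, `isRationalSurface3`;
* `current_term3` — `−3 μ₀ j′/(r F₃₂) = 560 r_s⁴/((7r_s² + 3r²)²(r² − r_s²))` (the coupling is the `(2,1)` one: same `σ`);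
* **`isCylOuterSolution_of_scaled3`** — scaled solutions of MODEL M₃ are printed solutions for mode `(3, 2)`;
* `tendsto_axis_scale3` (`Ψ/u³ → c` ⇒ `Ψ(r/r_s)/r³ → c/r_s³`);
* `no_growing_root3` — composition with lit-3's `Tearing.GlasserLayer.not_isGrowthRate_of_nonpos`: `Δ′ < 0` ⇒ no
  purely growing root of the printed GGJ layer dispersion relation (favourable curvature), any layer constants;
* **`physical_certificate3`** — THE SENTENCE: for every `r_s > 0`, `j₀ μ₀ ≠ 0`, `ψ(r) = M3.psi(r/r_s)` solves (9.61) of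
  `profile3` for `(m, n) = (3, 2)` on `0 < r < r_s` and `r > r_s`, is axis-regular (`ψ/r³ → a_L⁻¹/r_s³`), vanishes at
  the wall `r = 6 r_s`, `ψ(r_s) = 1`, and `Tearing.IsDeltaPrime ψ ψ′ r_s (deltaPrime/r_s)` with
  `-0.9119 < r_s Δ′ < -0.91185` — THE STABLE SIDE.
CERTIFIED: all of the above (kernel). MODELLED: MV-7R (zero β, straight cylinder, single helicity; profile used on
`0 < r < 6 r_s`, no vacuum region; `q₀ = 1.05` is a declared member of the printed family, not Ham et al.'s `1.4`).
VALIDATED: see `TearingFRS1M3DeltaPrime.lean`. Not about any device. [instance data]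
-/

noncomputable section

open Set Filter Literature.MathematicalPhysics.MHD
open scoped Topology

namespace Summit.Ventures.FusionMHD.Models

namespace TearingFRS1

namespace M3

/-! ### The profile of MODEL M₃ as a `Tearing.CylProfile` (`q₀ = 21/20`, `a² = 7 r_s²/3`) -/

/-- THE PROFILE OF MODEL M₃ as reduced cylindrical data: `B_θ = μ₀ j₀ r/(2(1 + r²/a²))` (as for `m = 2`),
`q = (21/20)(1 + r²/a²)`, `j′ = dj/dr`, with `a² = 7r_s²/3` (cleared fractions). [instance data] -/
def profile3 (rs j0 mu0 : ℝ) : Tearing.CylProfile where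
  Bθ r := mu0 * j0 * (7 * rs ^ 2) * r / (2 * (7 * rs ^ 2 + 3 * r ^ 2))
  q r := 3 * (7 * rs ^ 2 + 3 * r ^ 2) / (20 * rs ^ 2)
  djdr r := -588 * j0 * rs ^ 4 * r / (7 * rs ^ 2 + 3 * r ^ 2) ^ 3
  mu0 := mu0

variable {rs j0 mu0 : ℝ}

/-- The printed shapes: `B_θ = μ₀ j₀ r/(2(1 + r²/a²))`, `q = (21/20)(1 + r²/a²)` with `a² = 7 r_s²/3`. [instance data] -/
theorem printed_forms3 (hrs : rs ≠ 0) (r : ℝ) :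
    (profile3 rs j0 mu0).Bθ r = mu0 * j0 * r / (2 * (1 + r ^ 2 / (7 * rs ^ 2 / 3))) ∧
      (profile3 rs j0 mu0).q r = 21 / 20 * (1 + r ^ 2 / (7 * rs ^ 2 / 3)) := by
  have hd := (den_pos hrs r).ne'
  have h7 : (7 * rs ^ 2 : ℝ) ≠ 0 := by positivity
  refine ⟨?_, ?_⟩
  · simp only [profile3]; field_simp
  · simp only [profile3]; field_simp; ring

/-- CONSISTENCY 1: `djdr` IS the derivative of `j` (`TearingFRS1.jz`; same current as the `(2,1)` instance). [instance data] -/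
theorem hasDerivAt_j3 (hrs : rs ≠ 0) (r : ℝ) : HasDerivAt (jz rs j0) ((profile3 rs j0 mu0).djdr r) r :=
  hasDerivAt_j (mu0 := mu0) hrs r

/-- CONSISTENCY 2 (Ampère): `(r B_θ)′ = μ₀ r j`. [instance data] -/
theorem ampere3 (hrs : rs ≠ 0) (r : ℝ) :
    HasDerivAt (fun r => r * (profile3 rs j0 mu0).Bθ r) (mu0 * r * jz rs j0 r) r :=
  ampere hrs r

/-- CONSISTENCY 3: `q = r B_z/(R₀ B_θ)` for every `r ≠ 0` as soon as `q₀ = 2B_z/(μ₀ j₀ R₀) = 21/20`. [instance data] -/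
theorem q_of_Bz3 (hrs : rs ≠ 0) (hj : j0 ≠ 0) (hmu : mu0 ≠ 0) {Bz R0 r : ℝ} (hR : R0 ≠ 0) (hr : r ≠ 0)
    (hq0 : 2 * Bz / (mu0 * j0 * R0) = 21 / 20) :
    (profile3 rs j0 mu0).q r = r * Bz / (R0 * (profile3 rs j0 mu0).Bθ r) := by
  have hd := (den_pos hrs r).ne'
  have hmjR : mu0 * j0 * R0 ≠ 0 := by positivity
  have hBz : Bz = 21 / 40 * (mu0 * j0 * R0) := by
    rw [div_eq_iff hmjR] at hq0
    linarith
  subst hBz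
  simp only [profile3]
  field_simp
  ring

/-- CONSISTENCY 4: `r_s` is the rational surface of the mode `(3, 2)`: `q(r_s) = 3/2`. [instance data] -/
theorem isRationalSurface3 (hrs : 0 < rs) : (profile3 rs j0 mu0).IsRationalSurface 3 2 rs := by
  refine ⟨hrs, ?_⟩
  simp only [profile3]
  push_cast
  field_simp
  ring

/-- `F₃₂ = (B_θ/r)(2 q − 3) = 63 μ₀ j₀ (r² − r_s²)/(20 (7 r_s² + 3 r²))` for `r ≠ 0`: vanishes exactly at `r = r_s`.
[instance data] -/
theorem F_eq3 (hrs : rs ≠ 0) {r : ℝ} (hr : r ≠ 0) :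
    (profile3 rs j0 mu0).F 3 2 r = 63 * mu0 * j0 * (r ^ 2 - rs ^ 2) / (20 * (7 * rs ^ 2 + 3 * r ^ 2)) := by
  have hd := (den_pos hrs r).ne'
  simp only [Tearing.CylProfile.F, profile3]
  push_cast
  field_simp
  ring

/-- THE KEY IDENTITY (`m = 3`): `−3 μ₀ j′(r)/(r F₃₂(r)) = 560 r_s⁴/((7r_s² + 3r²)²(r² − r_s²))` — the same coupling as for
the `(2,1)` mode at `q₀ = 7/5` (same `σ = 3/7`). [instance data] -/
theorem current_term3 (hrs : rs ≠ 0) (hj : j0 ≠ 0) (hmu : mu0 ≠ 0) {r : ℝ} (hr : r ≠ 0) (hr1 : r ^ 2 ≠ rs ^ 2) :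
    -((3 : ℝ) * (profile3 rs j0 mu0).mu0 * (profile3 rs j0 mu0).djdr r / (r * (profile3 rs j0 mu0).F 3 2 r)) =
      560 * rs ^ 4 / ((7 * rs ^ 2 + 3 * r ^ 2) ^ 2 * (r ^ 2 - rs ^ 2)) := by
  have hd := (den_pos hrs r).ne'
  have hr2 : r ^ 2 - rs ^ 2 ≠ 0 := sub_ne_zero.2 hr1
  rw [F_eq3 hrs hr]
  simp only [profile3]
  field_simp
  ring

/-! ### Scaled solutions are printed solutions (`m = 3`) -/

/-- **THE BRIDGE (`m = 3`).** A scaled outer solution `(Ψ, Ψ′)` of MODEL M₃ on `s` gives a solution of the PRINTED outer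
equation [Miyamoto2007 (9.61)] of `profile3`, mode `(3,2)`: `ψ(r) = Ψ(r/r_s)`, `ψ′(r) = Ψ′(r/r_s)/r_s`. [instance data] -/
theorem isCylOuterSolution_of_scaled3 (hrs : 0 < rs) (hj : j0 ≠ 0) (hmu : mu0 ≠ 0) {Ψ Ψ' : ℝ → ℝ} {s t : Set ℝ}
    (hΨ : M3.IsScaledOuterSolution Ψ Ψ' s) (hts : ∀ r ∈ t, r / rs ∈ s ∧ r ≠ 0 ∧ r ^ 2 ≠ rs ^ 2) :
    Tearing.IsCylOuterSolution (profile3 rs j0 mu0) 3 2 (fun r => Ψ (r / rs)) (fun r => Ψ' (r / rs) / rs) t := by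
  intro r hr
  obtain ⟨hu, hr0, hr1⟩ := hts r hr
  have hrs0 : rs ≠ 0 := hrs.ne'
  obtain ⟨h1, h2⟩ := hΨ (r / rs) hu
  have hd : HasDerivAt (fun r : ℝ => r / rs) (1 / rs) r := (hasDerivAt_id r).div_const rs
  refine ⟨?_, ?_⟩
  · exact (h1.comp r hd).congr_deriv (by ring)
  · have h := (h2.comp r hd).div_const rs
    refine h.congr_deriv ?_
    have hct := current_term3 (j0 := j0) (mu0 := mu0) hrs0 hj hmu hr0 hr1
    have hden := (den_pos hrs0 r).ne'
    have hr2 : r ^ 2 - rs ^ 2 ≠ 0 := sub_ne_zero.2 hr1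
    have hu2 : (r / rs) ^ 2 - 1 ≠ 0 := by
      rw [div_pow, div_sub_one (pow_ne_zero 2 hrs0)]
      exact div_ne_zero hr2 (pow_ne_zero 2 hrs0)
    have h73 : (7 + 3 * (r / rs) ^ 2 : ℝ) ≠ 0 := by positivity
    have key : ((3 : ℤ) : ℝ) ^ 2 / r ^ 2 - ((3 : ℤ) : ℝ) * (profile3 rs j0 mu0).mu0 * (profile3 rs j0 mu0).djdr r
          / (r * (profile3 rs j0 mu0).F 3 2 r) =
        (9 / (r / rs) ^ 2 + 560 / ((7 + 3 * (r / rs) ^ 2) ^ 2 * ((r / rs) ^ 2 - 1))) / rs ^ 2 := by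
      have e1 : ((3 : ℤ) : ℝ) ^ 2 / r ^ 2 - ((3 : ℤ) : ℝ) * (profile3 rs j0 mu0).mu0 * (profile3 rs j0 mu0).djdr r
          / (r * (profile3 rs j0 mu0).F 3 2 r) = 9 / r ^ 2 + 560 * rs ^ 4 / ((7 * rs ^ 2 + 3 * r ^ 2) ^ 2 * (r ^ 2 - rs ^ 2)) := by
        rw [← hct]; push_cast; ring
      rw [e1]
      rw [div_pow]
      field_simp
    rw [key]
    field_simp

/-- Axis scaling for the `m = 3` exponent: `Ψ(u)/u³ → c` as `u → 0⁺` gives `Ψ(r/r_s)/r³ → c/r_s³` as `r → 0⁺`. [folklore] -/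
theorem tendsto_axis_scale3 (hrs : 0 < rs) {Ψ : ℝ → ℝ} {c : ℝ} (h : Tendsto (fun u => Ψ u / u ^ 3) (𝓝[>] 0) (𝓝 c)) :
    Tendsto (fun r => Ψ (r / rs) / r ^ 3) (𝓝[>] 0) (𝓝 (c / rs ^ 3)) := by
  have h2 := (h.comp (tendsto_div_nhdsGT hrs)).div_const (rs ^ 3)
  refine h2.congr' ?_
  filter_upwards [self_mem_nhdsWithin] with r hr
  have hr0 : (r : ℝ) ≠ 0 := ne_of_gt hr
  have hrs0 : rs ≠ 0 := hrs.ne'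
  show Ψ (r / rs) / (r / rs) ^ 3 / rs ^ 3 = Ψ (r / rs) / r ^ 3
  rw [div_pow]
  field_simp

/-! ### The certificate in printed variables -/

/-- **THE F3.r3 STABILITY-SIDE CERTIFICATE IN THE PRINTED VARIABLES.** For every rational-surface radius `r_s > 0`
(plasma scale `a = r_s √(7/3)`) and all `j₀, μ₀ ≠ 0`, with `P = profile3 r_s j₀ μ₀` and `ψ(r) = M3.psi(r/r_s)`,
`ψ′(r) = M3.psi'(r/r_s)/r_s`: `r_s` is the `(3,2)` rational surface of `P`; `ψ` solves the printed outer equation (9.61)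
of `P` for `(m,n) = (3,2)` on `0 < r < r_s` and on `r > r_s`; `ψ/r³ → a_L⁻¹/r_s³` at the axis (regular, `ψ ∝ r³`);
`ψ(6 r_s) = 0` (conducting wall); `ψ(r_s) = 1`; and the printed tearing index exists,
`Tearing.IsDeltaPrime ψ ψ′ r_s (deltaPrime/r_s)`, with `-0.9119 < r_s Δ′ < -0.91185` (NEGATIVE: the stable side of the
printed criterion). CERTIFIED for MODEL M₃ (MV-7R); not a statement about any device. [instance data] -/
theorem physical_certificate3 (hrs : 0 < rs) (hj : j0 ≠ 0) (hmu : mu0 ≠ 0) :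
    (profile3 rs j0 mu0).IsRationalSurface 3 2 rs ∧
      Tearing.IsCylOuterSolution (profile3 rs j0 mu0) 3 2 (fun r => M3.psi (r / rs)) (fun r => M3.psi' (r / rs) / rs) (Ioo 0 rs) ∧
      Tearing.IsCylOuterSolution (profile3 rs j0 mu0) 3 2 (fun r => M3.psi (r / rs)) (fun r => M3.psi' (r / rs) / rs) (Ioi rs) ∧
      Tendsto (fun r => M3.psi (r / rs) / r ^ 3) (𝓝[>] 0) (𝓝 (M3.aL⁻¹ / rs ^ 3)) ∧
      M3.psi (6 * rs / rs) = 0 ∧ M3.psi (rs / rs) = 1 ∧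
      Tearing.IsDeltaPrime (fun r => M3.psi (r / rs)) (fun r => M3.psi' (r / rs) / rs) rs (M3.deltaPrime / rs) ∧
      ((-9119 / 10000 : ℝ)) < rs * (M3.deltaPrime / rs) ∧ rs * (M3.deltaPrime / rs) < ((-18237 / 20000 : ℝ)) := by
  have hrs0 : rs ≠ 0 := hrs.ne'
  refine ⟨isRationalSurface3 hrs, ?_, ?_, tendsto_axis_scale3 hrs psi_axis_limit, ?_, ?_,
    isDeltaPrime_scale hrs isDeltaPrime_psi, ?_, ?_⟩
  · refine isCylOuterSolution_of_scaled3 hrs hj hmu psi_outer_left fun r hr => ⟨?_, hr.1.ne', ?_⟩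
    · exact ⟨div_pos hr.1 hrs, (div_lt_one hrs).2 hr.2⟩
    · intro h; have := abs_eq_abs.1 ((sq_eq_sq_iff_abs_eq_abs r rs).1 h)
      rcases this with h1 | h1 <;> linarith [hr.1, hr.2]
  · refine isCylOuterSolution_of_scaled3 hrs hj hmu psi_outer_right fun r hr => ⟨?_, ?_, ?_⟩
    · show 1 < r / rs
      exact (one_lt_div hrs).2 hr
    · have : rs < r := hr
      linarith
    · intro h; have := abs_eq_abs.1 ((sq_eq_sq_iff_abs_eq_abs r rs).1 h)
      have hr' : rs < r := hr
      rcases this with h1 | h1 <;> linarith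
  · rw [mul_div_assoc, div_self hrs0, mul_one]; exact psi_wall
  · rw [div_self hrs0]; exact psi_one
  · rw [mul_div_cancel₀ _ hrs0]; exact deltaPrime_bounds.1
  · rw [mul_div_cancel₀ _ hrs0]; exact deltaPrime_bounds.2

/-! ### Composition with the printed finite-β layer model (lit-3's `TearingGlasserEffect.lean`) -/

/-- **NO PURELY GROWING GGJ ROOT AT THE (3,2) SURFACE OF MODEL M₃.** Since the certified outer index is negative
(`Δ′ = deltaPrime/r_s < 0` for every `r_s > 0`), the printed Glasser–Greene–Johnson layer dispersion relation
`Δ′ = Δ_GGJ(γ)` [HamEtAl2013 §1] with favourable average curvature (`D_R ≤ 0`) and any layer constants `A > 0`, `B ≥ 0`,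
`τ_A > 0` has NO root `γ > 0` (`Tearing.GlasserLayer.not_isGrowthRate_of_nonpos`, lit-3 p498437): the conservative
side «`Δ′ < 0` suffices» of models/F3-SCOPING.md §3 W2, composed in the kernel. MODELLED: zero-β outer region (MODEL M₃)
+ the printed GGJ layer model; the layer constants are NOT computed for any equilibrium here. [instance data] -/
theorem no_growing_root3 (hrs : 0 < rs) {A B DR τA : ℝ} (hA : 0 < A) (hB : 0 ≤ B) (hDR : DR ≤ 0) (hτ : 0 < τA)
    (γ : ℝ) : ¬ Tearing.GlasserLayer.IsGrowthRate A B DR τA (M3.deltaPrime / rs) γ :=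
  Tearing.GlasserLayer.not_isGrowthRate_of_nonpos hA hB hDR hτ (div_nonpos_of_nonpos_of_nonneg deltaPrime_val.2.le hrs.le) γ

end M3

end TearingFRS1

end Summit.Ventures.FusionMHD.Models

end
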